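import Mathlib
import HarnessLib
import Summits.Ventures.LatticeQCDFlow.Scoring.ChainTimeAverage
import Summits.Ventures.LatticeQCDFlow.Scoring.DoeblinGreenKubo

/-!
# Burn-in, certified: from ANY initial law the chain's one-time expectations are `(kop κ)^[t] f`
# integrated against the start, and a Doeblin constant bounds the thermalisation bias by
# `(1 − ε/2)ᵗ` per step and `2(C + |π f|)/(ε N)` for the time average

HONEST FRAMING: exact (Metropolis-corrected) sampling algorithms for lattice gauge theory;
figures of merit are autocorrelation/cost numbers at stated couplings and volumes; no
continuum-physics claim.

Venture `LatticeQCDFlow` (cell pub-lqcd), topic `Scoring`; FANOUT row 8 (`s0-cpn-nemc`, GEN-12).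
NEW WORK of the cell, not a published result; no definition is introduced.  The companion of
`Scoring/ChainTimeAverage.lean` (the bridge to Mathlib's `Kernel.trajMeasure`, written there for the
chain started in its invariant law) for an ARBITRARY initial law `μ₀` — a cold or hot start, the
current state of another sampler — composed with GEN-10's sup-norm decay of centred observables
under Doeblin by `π` (`Scoring/DoeblinGreenKubo.abs_iterate_kop_le_of_doeblin`).  Printed
counterpart NAMED ONLY: the geometric-ergodicity / burn-in bound for uniformly ergodic chains
(Meyn–Tweedie 1993 Thm 16.0.2; Rosenthal 1995).

## Content (`κ` Markov, `P_{μ₀} = trajMeasure μ₀ (n ↦ κ ∘ eval n)`, `f` bounded measurable)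

* **`chain_initial`** — the time-`0` marginal of `P_{μ₀}` is `μ₀`: `E_{μ₀}[f(X_0)] = ∫ f dμ₀`;
* **`chain_expect`** — `E_{μ₀}[f(X_t)] = ∫ (kop κ)^[t] f dμ₀` for every `t` (the `t`-step law on
  observables, from the tower property of `ChainTimeAverage.lean`);
* **`chain_bias_le_of_doeblin`** — with `π` invariant and `κ(x, ·) ≥ ε π` (`ε > 0`), for EVERY
  initial law `μ₀`: `|E_{μ₀}[f(X_t)] − ∫ f dπ| ≤ (1 − ε/2)ᵗ · (C + |∫ f dπ|)` (`|f| ≤ C`);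
* **`chain_timeAverage_bias_le_of_doeblin`** — hence the THERMALISATION BIAS of the time average is
  `|E_{μ₀}[(1/N) Σ_{i<N} f(X_i)] − ∫ f dπ| ≤ 2 (C + |∫ f dπ|) / (ε N)` for every `N ≥ 1`: no burn-in
  cut is needed for a certified `O(1/N)` bias, and a cut of `b` steps leaves at most
  `(1 − ε/2)^b`-suppressed terms (`chain_bias_le_of_doeblin` termwise).

Reading (value-free, for the scorers and the flow seat): with the exact flow sampler's
`ε = e^{−2δ}` (`Exactness.flowSampler_exact_doeblin`) the bias of an `N`-step average from a cold
start is `≤ 2e^{2δ}(C + |πf|)/N` — below the stationary error bar `√((2e^{2δ} − 1) Var f / N)` of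
`Scoring/FlowSamplerTimeAverage.lean` as soon as `N ≳ 4e^{2δ}(C + |πf|)²/Var f`.  NOT CLAIMED: any
number of ours; variance bounds for non-stationary starts (the variance identity of
`ChainTimeAverage.lean` is for the stationary chain).
-/

noncomputable section

namespace Summit.Ventures.LatticeQCDFlow.Scoring

open MeasureTheory ProbabilityTheory Filter Finset Preorder
open scoped ENNReal

variable {Ω : Type*} [MeasurableSpace Ω]

section BurnIn

variable (κ : Kernel Ω Ω) [IsMarkovKernel κ] (μ₀ : Measure Ω) [IsProbabilityMeasure μ₀]

omit [IsProbabilityMeasure μ₀] in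
/-- **The time-`0` marginal is the initial law**: `E_{μ₀}[f(X_0)] = ∫ f dμ₀`. -/
theorem chain_initial {f : Ω → ℝ} (hf : Measurable f) :
    ∫ x, f (x 0) ∂(Kernel.trajMeasure (X := fun _ : ℕ => Ω) μ₀
        (fun n : ℕ => κ.comap (fun h : (i : ↥(Finset.Iic n)) → Ω => h ⟨n, Finset.mem_Iic.2 le_rfl⟩)
          (measurable_pi_apply _)))
      = ∫ x, f x ∂μ₀ := by
  set P := Kernel.trajMeasure (X := fun _ : ℕ => Ω) μ₀
      (fun n : ℕ => κ.comap (fun h : (i : ↥(Finset.Iic n)) → Ω => h ⟨n, Finset.mem_Iic.2 le_rfl⟩)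
        (measurable_pi_apply _)) with hP
  have h0 : (0 : ℕ) ∈ Finset.Iic 0 := Finset.mem_Iic.2 le_rfl
  have hmap : P.map (frestrictLe 0)
      = μ₀.map (MeasurableEquiv.piUnique (fun i : ↥(Finset.Iic 0) => Ω)).symm := by
    rw [hP, Kernel.trajMeasure, Measure.map_comp _ _ (measurable_frestrictLe 0),
      Kernel.traj_map_frestrictLe_of_le le_rfl, Measure.deterministic_comp_eq_map]
    ext S hS
    rw [Measure.map_apply (measurable_frestrictLe₂ _) hS]
    congr 1
  have hFm : Measurable fun h : (i : ↥(Finset.Iic 0)) → Ω => f (h ⟨0, h0⟩) :=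
    hf.comp (measurable_pi_apply _)
  calc ∫ x, f (x 0) ∂P = ∫ h, f (h ⟨0, h0⟩) ∂(P.map (frestrictLe 0)) := by
        rw [integral_map (measurable_frestrictLe 0).aemeasurable hFm.aestronglyMeasurable]
        rfl
    _ = ∫ z, f z ∂μ₀ := by
        rw [hmap, integral_map (MeasurableEquiv.measurable _).aemeasurable hFm.aestronglyMeasurable]
        refine integral_congr_ae (ae_of_all _ fun z => ?_)
        show f ((MeasurableEquiv.piUnique (fun i : ↥(Finset.Iic 0) => Ω)).symm z ⟨0, h0⟩) = f z
        rw [MeasurableEquiv.piUnique_symm_apply,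
          Unique.eq_default (⟨0, h0⟩ : ↥(Finset.Iic 0)), uniqueElim_default]

/-- **The `t`-step law on observables**: `E_{μ₀}[f(X_t)] = ∫ (kop κ)^[t] f dμ₀` for every initial
law `μ₀`, every `t` and every bounded measurable `f`. -/
theorem chain_expect {f : Ω → ℝ} (hf : Measurable f) {C : ℝ} (hC : ∀ x, |f x| ≤ C) (t : ℕ) :
    ∫ x, f (x t) ∂(Kernel.trajMeasure (X := fun _ : ℕ => Ω) μ₀
        (fun n : ℕ => κ.comap (fun h : (i : ↥(Finset.Iic n)) → Ω => h ⟨n, Finset.mem_Iic.2 le_rfl⟩)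
          (measurable_pi_apply _)))
      = ∫ x, (kop κ)^[t] f x ∂μ₀ := by
  obtain ⟨hm, -⟩ := iterate_kop_bounded_measurable κ hf hC t
  have h := chain_twoTime κ μ₀ 0 (f := fun _ => (1 : ℝ)) measurable_const (Cf := 1)
    (fun _ => by simp) t hf hC
  simp only [one_mul, Nat.zero_add] at h
  rw [h, chain_initial κ μ₀ hm]

variable {κ μ₀}

/-- **Certified burn-in, per step**: with `π` invariant and `κ(x, ·) ≥ ε π` (`ε > 0`), for EVERY
initial law `μ₀` and every bounded measurable `f` (`|f| ≤ C`):
`|E_{μ₀}[f(X_t)] − ∫ f dπ| ≤ (1 − ε/2)ᵗ · (C + |∫ f dπ|)`. -/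
theorem chain_bias_le_of_doeblin {π : Measure Ω} [IsProbabilityMeasure π] (hπ : Kernel.Invariant κ π)
    {ε : ℝ≥0∞} (hmin : ∀ x {B : Set Ω}, MeasurableSet B → ε * π B ≤ κ x B) (hε0 : 0 < ε)
    {f : Ω → ℝ} (hf : Measurable f) {C : ℝ} (hC : ∀ x, |f x| ≤ C) (t : ℕ) :
    |∫ x, f (x t) ∂(Kernel.trajMeasure (X := fun _ : ℕ => Ω) μ₀
        (fun n : ℕ => κ.comap (fun h : (i : ↥(Finset.Iic n)) → Ω => h ⟨n, Finset.mem_Iic.2 le_rfl⟩)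
          (measurable_pi_apply _))) - ∫ x, f x ∂π|
      ≤ (1 - (ε / 2).toReal) ^ t * (C + |∫ x, f x ∂π|) := by
  set m := ∫ x, f x ∂π with hm
  have hgm : Measurable fun y => f y - m := hf.sub measurable_const
  have hgb : ∀ y, |f y - m| ≤ C + |m| := fun y => (abs_sub _ _).trans (add_le_add (hC y) le_rfl)
  have hg0 : ∫ y, (f y - m) ∂π = 0 := by
    rw [integral_sub (integrable_of_bounded π hf hC) (integrable_const _), integral_const,
      probReal_univ, one_smul, hm, sub_self]
  obtain ⟨hKm, hKb⟩ := iterate_kop_bounded_measurable κ hf hC t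
  have hshift := iterate_kop_sub_const (κ := κ) hf hC m t
  -- `E_{μ₀}[f(X_t)] − m = ∫ (kop κ)^[t] (f − m) dμ₀`
  have hdiff : ∫ x, f (x t) ∂(Kernel.trajMeasure (X := fun _ : ℕ => Ω) μ₀
        (fun n : ℕ => κ.comap (fun h : (i : ↥(Finset.Iic n)) → Ω => h ⟨n, Finset.mem_Iic.2 le_rfl⟩)
          (measurable_pi_apply _))) - m
      = ∫ x, (kop κ)^[t] (fun y => f y - m) x ∂μ₀ := by
    rw [chain_expect κ μ₀ hf hC t, hshift, integral_sub (integrable_of_bounded μ₀ hKm hKb)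
      (integrable_const _), integral_const, probReal_univ, one_smul]
  rw [hdiff]
  calc |∫ x, (kop κ)^[t] (fun y => f y - m) x ∂μ₀|
      = ‖∫ x, (kop κ)^[t] (fun y => f y - m) x ∂μ₀‖ := (Real.norm_eq_abs _).symm
    _ ≤ (1 - (ε / 2).toReal) ^ t * (C + |m|) * μ₀.real Set.univ :=
        norm_integral_le_of_norm_le_const (Eventually.of_forall fun x => by
          rw [Real.norm_eq_abs]
          exact abs_iterate_kop_le_of_doeblin hπ hmin hε0 hgm hgb hg0 t x)
    _ = (1 - (ε / 2).toReal) ^ t * (C + |m|) := by rw [probReal_univ, mul_one]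

/-- **Certified burn-in for the time average**: under the same hypotheses, for every `N ≥ 1`:
`|E_{μ₀}[(1/N) Σ_{i<N} f(X_i)] − ∫ f dπ| ≤ 2 (C + |∫ f dπ|) / (ε N)`. -/
theorem chain_timeAverage_bias_le_of_doeblin {π : Measure Ω} [IsProbabilityMeasure π]
    (hπ : Kernel.Invariant κ π) {ε : ℝ≥0∞}
    (hmin : ∀ x {B : Set Ω}, MeasurableSet B → ε * π B ≤ κ x B) (hε0 : 0 < ε)
    {f : Ω → ℝ} (hf : Measurable f) {C : ℝ} (hC : ∀ x, |f x| ≤ C) {N : ℕ} (hN : N ≠ 0) :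
    |∫ x, (∑ i ∈ Finset.range N, f (x i)) / N ∂(Kernel.trajMeasure (X := fun _ : ℕ => Ω) μ₀
        (fun n : ℕ => κ.comap (fun h : (i : ↥(Finset.Iic n)) → Ω => h ⟨n, Finset.mem_Iic.2 le_rfl⟩)
          (measurable_pi_apply _))) - ∫ x, f x ∂π|
      ≤ 2 * (C + |∫ x, f x ∂π|) / (ε.toReal * N) := by
  set P := Kernel.trajMeasure (X := fun _ : ℕ => Ω) μ₀
      (fun n : ℕ => κ.comap (fun h : (i : ↥(Finset.Iic n)) → Ω => h ⟨n, Finset.mem_Iic.2 le_rfl⟩)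
        (measurable_pi_apply _)) with hP
  set m := ∫ x, f x ∂π with hm
  obtain ⟨hlt, hl0, hl1, -, hr, hεr0⟩ := half_const_bounds hmin hε0
  have hNpos : (0 : ℝ) < N := by exact_mod_cast Nat.pos_of_ne_zero hN
  have hCm : 0 ≤ C + |m| := by
    obtain ⟨x⟩ := nonempty_of_isProbabilityMeasure π
    exact add_nonneg ((abs_nonneg _).trans (hC x)) (abs_nonneg _)
  -- per-coordinate integrability and the per-step bias
  have hint : ∀ i, Integrable (fun x : ℕ → Ω => f (x i)) P := fun i =>
    integrable_of_bounded P (hf.comp (measurable_pi_apply i)) fun x => hC (x i)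
  have hstep : ∀ i, |∫ x, f (x i) ∂P - m| ≤ (1 - (ε / 2).toReal) ^ i * (C + |m|) := fun i => by
    rw [hP]; exact chain_bias_le_of_doeblin (μ₀ := μ₀) hπ hmin hε0 hf hC i
  -- the mean of the average is the average of the means
  have hmean : ∫ x, (∑ i ∈ Finset.range N, f (x i)) / N ∂P
      = (∑ i ∈ Finset.range N, ∫ x, f (x i) ∂P) / N := by
    rw [show (fun x : ℕ → Ω => (∑ i ∈ Finset.range N, f (x i)) / N)
        = fun x => (N : ℝ)⁻¹ * ∑ i ∈ Finset.range N, f (x i) by funext x; rw [div_eq_inv_mul],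
      integral_const_mul, integral_finsetSum _ (fun i _ => hint i), ← div_eq_inv_mul]
  rw [hmean]
  have hsub : (∑ i ∈ Finset.range N, ∫ x, f (x i) ∂P) / N - m
      = (∑ i ∈ Finset.range N, (∫ x, f (x i) ∂P - m)) / N := by
    rw [Finset.sum_sub_distrib, Finset.sum_const, Finset.card_range, nsmul_eq_mul]
    field_simp
  rw [hsub, abs_div, abs_of_pos hNpos]
  -- Σ_i (1 − ε/2)^i ≤ 2/ε
  have hgeo : ∑ i ∈ Finset.range N, (1 - (ε / 2).toReal) ^ i ≤ 2 / ε.toReal := by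
    have hlt1 : |1 - (ε / 2).toReal| < 1 := by rw [abs_of_nonneg hl0]; exact hl1
    have hs := sum_le_hasSum (Finset.range N) (fun i _ => pow_nonneg hl0 i)
      (hasSum_geometric_of_abs_lt_one hlt1)
    rw [hr] at hs ⊢
    have : (1 - (1 - ε.toReal / 2))⁻¹ = 2 / ε.toReal := by
      rw [sub_sub_cancel, inv_div]
    linarith [this]
  have key : |∑ i ∈ Finset.range N, (∫ x, f (x i) ∂P - m)| ≤ 2 * (C + |m|) / ε.toReal :=
    calc |∑ i ∈ Finset.range N, (∫ x, f (x i) ∂P - m)|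
        ≤ ∑ i ∈ Finset.range N, |∫ x, f (x i) ∂P - m| := Finset.abs_sum_le_sum_abs _ _
      _ ≤ ∑ i ∈ Finset.range N, (1 - (ε / 2).toReal) ^ i * (C + |m|) :=
          Finset.sum_le_sum fun i _ => hstep i
      _ = (∑ i ∈ Finset.range N, (1 - (ε / 2).toReal) ^ i) * (C + |m|) := by
          rw [Finset.sum_mul]
      _ ≤ 2 / ε.toReal * (C + |m|) := mul_le_mul_of_nonneg_right hgeo hCm
      _ = 2 * (C + |m|) / ε.toReal := by ring
  calc |∑ i ∈ Finset.range N, (∫ x, f (x i) ∂P - m)| / N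
      ≤ 2 * (C + |m|) / ε.toReal / N := div_le_div_of_nonneg_right key hNpos.le
    _ = 2 * (C + |m|) / (ε.toReal * N) := by rw [div_div]
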